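import Summits.QuantumFields.BalabanUV.T4Continuum.Spine.NE2.ComposedRemainderCoherentTowerSizes
import Summits.QuantumFields.BalabanUV.T4Continuum.Spine.NE2.ConstantConnectionTower

/-!
# T⁴ programme, spine node NE2 (U1a) — NON-FLAT WITNESSES OF THE COHERENT-TOWER END: THE (3.26)-SHAPE END AT THE CONSTANT-CONNECTION AND STATIONARY TOWERS (cell `pub-balaban-gaps`, seat ne2 gen 8)

`ComposedRemainderCoherentTowerSizes.composed_full_averaging_deltaPrime_rate_of_coherentTowers_top` (the END of record for [B9] (3.26) at model level) had ONE non-vacuity witness,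
the flat tower (`…_top_flat`), at which every operator of the tower is the free one.  With the constant-per-level towers `u_k^{(i)} ≡ exp(f(k,i)X)` of `ConstantConnectionTower`
(`f = cph`: `L^{−(k+i)}`; `f = sph`: the STATIONARY `L^{−i}`; coherent by [B7] (42); DATA letters `(α_U, β_U, σ_U, θ_c, p_U) = (t, 0, t, L⁻¹, 0)`, `t = ‖X‖e^{‖X‖}`, `Δ′` letters `0`):
 * §1 `PhiC` = the END's smallness expression at these letters with `C = 4t` (literally the argument of `hsmall` with the substitutions); continuous in `t`, `PhiC 0 = 0`, so
   `∃ t₀ > 0, |t| < t₀ ⟹ PhiC t < 1` (`exists_PhiC_lt_one`);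
 * §2–§3 **`localRate_cTow_sph`** — node NE3's `LocalRate` at the STATIONARY tower with `C = 4t`, by a genuine SECOND-ORDER CANCELLATION: each connection reading
   `L^k(Ad(exp(L^{−k}X)) − 1)` is `O(t)`, not small; with `A = Ad(exp(L^{−(k+1)}X))`, `Ad(exp(L^{−k}X)) = A^L` and `L^{k+1}(A − 1) − L^k(A^L − 1) = −L^k(A^L − 1 − L(A − 1))`,
   `‖A^L − 1 − L(A − 1)‖ ≤ L²‖A − 1‖²` (`norm_pow_sub_one_sub_nsmul_le`), whence `≤ 4t²·L^{−k}` — the η-derivative statement NE3's shape asks for, met non-trivially;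
 * §4 **`composed_full_averaging_deltaPrime_rate_of_coherentTowers_top_cTow`**: for every skew-hermitian `X` with `t ≤ 1/16`, coherent phases `f` in `[0,1]` flat above the top with
   `f(k,k) ≤ L^{−k}` and `0 ≤ f(k,i) − f(k+1,i) ≤ L^{−k}L^{−i}`, NE3's letter and `PhiC t < 1`, the resolvent tower of [free block Laplacian] + [tier B at `Ad u_top`] + [print's
   composed averaging `TBal(Ad u)` with (124)'s remainders `Erem`] + [`Δ′(u_top)`] at the tower converges at rate `ρ` (every displayed binder of the END discharged);
   **`exists_nonflat_coherent_witness`**: there is `t₀ > 0` such that EVERY skew-hermitian `X` with `‖X‖e^{‖X‖} < t₀` qualifies, for BOTH towers — an OPEN SET of data at which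
   (for `X ≠ 0`) the finest fields are not `1` and (for non-central `X`) the adjoint transport, the tier-B operators, the composed averaging tables and the (124)-remainders are
   NOT the flat ones.
HONEST FRAMING (T4-DAG p. 1).  A NON-VACUITY witness for the binder set of a model-level END; the data are a toy (constant connection), NOT Bałaban's minimiser; nothing of
Bałaban's asserted beyond print; NOT NE2; **NE2 (U1a) NOT PROVED**; spine PROVED 0/9 unchanged; NOT continuum YM / infinite volume / mass gap / Clay.  No `sorry`.
-/

noncomputable section

open scoped BigOperators ComplexConjugate Matrix Matrix.Norms.L2Operator Kronecker

namespace Summit.QuantumFields.BalabanUV.T4Continuum.NE2.ComposedRemainderCoherentTowerConstant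

open Literature.MathematicalPhysics.QuantumFieldTheory.Balaban1983to89
open Literature.MathematicalPhysics.QuantumFieldTheory.Balaban1983to89.B7Prop1Explicit (expUnit)
open Literature.MathematicalPhysics.QuantumFieldTheory.Balaban1983to89.B5Prop11Plancherel (Tor fine)
open Literature.MathematicalPhysics.QuantumFieldTheory.Balaban1983to89.B5G183RateUnitTower (lev)
open Summit.QuantumFields.BalabanUV.Beta.AdjointCarrierWiringEnd (CompFamily)
open Summit.QuantumFields.BalabanUV.T4Continuum
open Summit.QuantumFields.BalabanUV.T4Continuum.BalabanAveragedTowerUnit (idx Qlev cast_lev' lev_succ')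
open Summit.QuantumFields.BalabanUV.T4Continuum.KingPairingPlantedLaw (calDalev)
open Summit.QuantumFields.BalabanUV.T4Continuum.CovariantAveragingTower (TowerLimitRate)
open Summit.QuantumFields.BalabanUV.T4Continuum.RegularBackgroundTower (regClass connTower dconnTower connTower_eq betaNE3)
open Summit.QuantumFields.BalabanUV.T4Continuum.NE2FromNE3 (bgReadings localRate_of_consistent)
open Summit.QuantumFields.BalabanUV.T4Continuum.AbelianCovariantLaplacian (tauInv)
open Summit.QuantumFields.BalabanUV.T4Continuum.BalabanAveragedTowerModes (par)
open Summit.QuantumFields.BalabanUV.T4Continuum.BlockPairingGeometry (parT)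
open Literature.MathematicalPhysics.QuantumFieldTheory.Balaban1983to89.T4EtaRateMin (LocalRate)
open Summit.QuantumFields.BalabanUV.T4Continuum.CovariantAveragingSummand (kappaQ)
open Summit.QuantumFields.BalabanUV.T4Continuum.NE2BalabanLayer (tierBPert kappaB)
open Summit.QuantumFields.BalabanUV.T4Continuum.ColourCovariantLaplacian (kappaCol)
open Summit.QuantumFields.BalabanUV.T4Continuum.NE2.CovariantTableBalaban (TBal)
open Summit.QuantumFields.BalabanUV.T4Continuum.NE2.ComposedAveragingRemainder (avgPertFull)
open Summit.QuantumFields.BalabanUV.T4Continuum.NE2.ComposedRemainderTower (Erem cR)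
open Summit.QuantumFields.BalabanUV.T4Continuum.NE2.OneStepRemainderLoopCoeff (remCoeffOf)
open Summit.QuantumFields.BalabanUV.T4Continuum.NE2.ComposedRemainderGaugeTower (fundT adT)
open Summit.QuantumFields.BalabanUV.T4Continuum.NE2.ComposedRemainderRateLetters (GamU EU qN)
open Summit.QuantumFields.BalabanUV.T4Continuum.NE2.ComposedRemainderGaugeTowerRegular (topAdT)
open Summit.QuantumFields.BalabanUV.T4Continuum.NE2.AdjointFieldInstance (adRep norm_adRep_le_one norm_adRep_sub_one_le dist1_unitaryGroup)
open Summit.QuantumFields.BalabanUV.T4Continuum.NE2.TorusBlockAveragePlaquette (bavgTor)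
open Summit.QuantumFields.BalabanUV.T4Continuum.NE2.TorusBlockAverageConstant (tplaq_const)
open Summit.QuantumFields.BalabanUV.T4Continuum.NE2.ComposedRemainderCoherentTower (liftU)
open Summit.QuantumFields.BalabanUV.T4Continuum.NE2.DeltaPrimeHodgeRate (kappaDP2)
open Summit.QuantumFields.BalabanUV.T4Continuum.NE2.DeltaPrimeOperator (deltaPrime)
open Summit.QuantumFields.BalabanUV.T4Continuum.NE2.DeltaPrimeSecondOrder (kappaDP)
open Summit.QuantumFields.BalabanUV.T4Continuum.NE2.ComposedRemainderCoherentTowerDeltaPrime (topU)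
open Summit.QuantumFields.BalabanUV.T4Continuum.NE2.ComposedRemainderCoherentTowerSizes (Abar Kloop_nonneg composed_full_averaging_deltaPrime_rate_of_coherentTowers_top)
open Summit.QuantumFields.BalabanUV.T4Continuum.NE2.ConstantConnectionTower

variable {d : ℕ}

/-! ## §1 The smallness expression at the letters `(t, 0, t, L⁻¹, 0, 4t)` -/

section Small

variable (L : ℕ) {ι : Type} [Fintype ι] (a : ℝ)

/-- **THE END's SMALLNESS EXPRESSION AT THE LETTERS OF THE CONSTANT-CONNECTION TOWERS** `(α_U, β_U, σ_U, θ_c, p_U, C) = (t, 0, t, L⁻¹, 0, 4t)`, `Δ′` letters `0` — literally the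
argument of `hsmall` in `composed_full_averaging_deltaPrime_rate_of_coherentTowers_top` with these substitutions. [folklore] -/
def PhiC (ι : Type) [Fintype ι] (d L : ℕ) (a t : ℝ) : ℝ :=
  kappaB ι d a (2 * Abar d t 0) (2 * 0) (4 * t) (kappaQ d a (a : ℂ) (Fintype.card ι * (Real.exp ((((d + 1) * L : ℕ) : ℝ) * (2 * Abar d t 0)) - 1)
      + (1 + Fintype.card ι * (Real.exp ((((d + 1) * L : ℕ) : ℝ) * (2 * Abar d t 0)) - 1)) * cR d L ι * GamU d (2 * 0) * Real.exp (EU ι d L (Abar d t 0) (2 * 0)))) (kappaDP d a 0 0)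

/-- `PhiC` is continuous in `t` (polynomials, `max`, `exp`). [folklore] -/
theorem continuous_PhiC : Continuous (PhiC ι d L a) := by
  unfold PhiC kappaB kappaCol betaNE3 kappaQ kappaDP kappaDP2 Abar EU GamU qN cR
  fun_prop

/-- at `t = 0` (the flat letters) the smallness expression vanishes. [folklore] -/
theorem PhiC_zero : PhiC ι d L a 0 = 0 := by
  have hAb : Abar d 0 0 = 0 := by unfold Abar; ring
  have hG : GamU d (2 * 0) = 0 := by unfold GamU; rw [mul_zero, mul_zero]
  unfold PhiC
  rw [hAb, hG]
  simp [kappaB, kappaCol, kappaQ, betaNE3, kappaDP, kappaDP2]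

/-- **THE SMALLNESS INEQUALITY HOLDS FOR ALL SMALL `t`**: `∃ t₀ > 0, |t| < t₀ ⟹ PhiC t < 1`. [folklore] -/
theorem exists_PhiC_lt_one : ∃ t₀ : ℝ, 0 < t₀ ∧ ∀ t : ℝ, |t| < t₀ → PhiC ι d L a t < 1 := by
  have h0 : PhiC ι d L a 0 < 1 := by rw [PhiC_zero]; exact zero_lt_one
  have hev : ∀ᶠ t in nhds (0 : ℝ), PhiC ι d L a t < 1 := (continuous_PhiC L (ι := ι) (a := a)).continuousAt.eventually (gt_mem_nhds h0)
  obtain ⟨t₀, ht₀, h⟩ := Metric.eventually_nhds_iff.mp hev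
  exact ⟨t₀, ht₀, fun t ht => h (by rwa [Real.dist_eq, sub_zero])⟩

end Small

/-! ## §2 The second-order cancellation behind the stationary tower's NE3 letter -/

section SecondOrder

variable {A : Type*} [NormedRing A] [NormOneClass A]

/-- `‖a^j − 1‖ ≤ j·‖a − 1‖` for `‖a‖ ≤ 1` (telescoping). [folklore] -/
theorem norm_pow_sub_one_le_mul {a : A} (ha : ‖a‖ ≤ 1) : ∀ j : ℕ, ‖a ^ j - 1‖ ≤ j * ‖a - 1‖
  | 0 => by simp
  | j + 1 => by
      have e : a ^ (j + 1) - 1 = a ^ j * (a - 1) + (a ^ j - 1) := by rw [pow_succ]; noncomm_ring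
      have h1 : ‖a ^ j * (a - 1)‖ ≤ ‖a - 1‖ :=
        (norm_mul_le _ _).trans (mul_le_of_le_one_left (norm_nonneg _) ((norm_pow_le a j).trans (pow_le_one₀ (norm_nonneg a) ha)))
      rw [e, Nat.cast_succ]
      refine (norm_add_le _ _).trans ?_
      have := norm_pow_sub_one_le_mul ha j
      linarith

omit [NormOneClass A] in
/-- **the second-order identity**: `a^L − 1 − L·(a − 1) = (Σ_{j<L} (a^j − 1))·(a − 1)`. [folklore] -/
theorem pow_sub_one_sub_nsmul (a : A) (L : ℕ) : a ^ L - 1 - L • (a - 1) = (∑ j ∈ Finset.range L, (a ^ j - 1)) * (a - 1) := by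
  rw [Finset.sum_sub_distrib, Finset.sum_const, Finset.card_range, sub_mul, geom_sum_mul, smul_mul_assoc, one_mul]

/-- **the second-order bound**: `‖a^L − 1 − L·(a − 1)‖ ≤ L²·‖a − 1‖²` for `‖a‖ ≤ 1`. [folklore] -/
theorem norm_pow_sub_one_sub_nsmul_le {a : A} (ha : ‖a‖ ≤ 1) (L : ℕ) : ‖a ^ L - 1 - L • (a - 1)‖ ≤ (L : ℝ) ^ 2 * ‖a - 1‖ ^ 2 := by
  rw [pow_sub_one_sub_nsmul]
  refine (norm_mul_le _ _).trans ?_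
  have hs : ‖∑ j ∈ Finset.range L, (a ^ j - 1)‖ ≤ L * (L * ‖a - 1‖) := by
    refine (norm_sum_le _ _).trans ?_
    calc ∑ j ∈ Finset.range L, ‖a ^ j - 1‖ ≤ ∑ _j ∈ Finset.range L, (L : ℝ) * ‖a - 1‖ :=
          Finset.sum_le_sum fun j hj => (norm_pow_sub_one_le_mul ha j).trans
            (mul_le_mul_of_nonneg_right (by exact_mod_cast (Finset.mem_range.mp hj).le) (norm_nonneg _))
      _ = L * (L * ‖a - 1‖) := by rw [Finset.sum_const, Finset.card_range, nsmul_eq_mul]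
  calc ‖∑ j ∈ Finset.range L, (a ^ j - 1)‖ * ‖a - 1‖ ≤ L * (L * ‖a - 1‖) * ‖a - 1‖ := mul_le_mul_of_nonneg_right hs (norm_nonneg _)
    _ = (L : ℝ) ^ 2 * ‖a - 1‖ ^ 2 := by ring

end SecondOrder

/-! ## §3 Node NE3's letter at the STATIONARY tower: a genuine second-order cancellation -/

section Stationary

variable (L : ℕ) [NeZero L] (M : Fin d → ℕ) [hM : ∀ μ, NeZero (M μ)] {n : Type} [Fintype n] [DecidableEq n]
  {ι : Type} [Fintype ι] [DecidableEq ι] {c : ℝ} {P : Submodule ℝ (Matrix n n ℂ)} {e : ι → Matrix n n ℂ} (hF : CompFamily c P e)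

/-- **NODE NE3's `LocalRate` AT THE STATIONARY TOWER** `u_k^{(i)} ≡ exp(L^{−i}X)`, constant `C = 4t` (`t = ‖X‖e^{‖X‖} ≤ 1`): here EACH connection reading `L^k(Ad(exp(L^{−k}X)) − 1)` is
`O(t)`, NOT small — only the DIFFERENCE of consecutive readings is: with `A := Ad(exp(L^{−(k+1)}X))`, `Ad(exp(L^{−k}X)) = A^L` (`Ad` is a monoid hom, `exp(rX)^L = exp(LrX)`), and
`L^{k+1}(A − 1) − L^k(A^L − 1) = −L^k·(A^L − 1 − L(A − 1))` has norm `≤ L^k·L²·‖A − 1‖² ≤ L^{k+2}·(2t·L^{−(k+1)})² = 4t²·L^{−k}` — the η-DERIVATIVE statement NE3's shape asks for,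
met non-trivially. [folklore] -/
theorem localRate_cTow_sph [Nonempty n] [Nonempty ι] {X : Matrix n n ℂ} (hX : star X = -X) (ht1 : ‖X‖ * Real.exp ‖X‖ ≤ 1) :
    LocalRate (bgReadings L M (regClass L M (topAdT L M hF (liftU L M (cTow L M (sph L) X) (cTow_mem L M (sph L) hX))))) (4 * (‖X‖ * Real.exp ‖X‖)) ((L : ℝ)⁻¹) := by
  have hL : 1 ≤ L := Nat.one_le_iff_ne_zero.mpr (NeZero.ne L)
  have hL1 : (1 : ℝ) ≤ L := by exact_mod_cast hL
  set t : ℝ := ‖X‖ * Real.exp ‖X‖ with ht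
  have ht0 : 0 ≤ t := by positivity
  set R := topAdT L M hF (liftU L M (cTow L M (sph L) X) (cTow_mem L M (sph L) hX)) with hR
  have hconst : ∀ k ν (i j : idx L M k), connTower L M R k ν i = connTower L M R k ν j := fun k ν i j => rfl
  have hdconn : ∀ k ν (i : idx L M k), dconnTower L M R k ν i = 0 := fun k ν i => by
    rw [dconnTower, hconst k ν i (tauInv (fine (lev L k) M) ν i), sub_self, smul_zero]
  refine localRate_of_consistent L M fun W hW k ν x' => ?_
  rcases hW with rfl | rfl
  · -- the connection: second-order cancellation
    set g : Matrix.unitaryGroup n ℂ := liftU L M (cTow L M (sph L) X) (cTow_mem L M (sph L) hX) (k + 1) (k + 1) ν x' with hg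
    have hs1 : sph L (k + 1) (k + 1) ≤ 1 := by rw [sph_top]; exact inv_le_one_of_one_le₀ (one_le_pow₀ hL1)
    have hgm1 : ‖(g : Matrix n n ℂ) - 1‖ ≤ sph L (k + 1) (k + 1) * t := norm_exp_smul_sub_one_le (sph_nonneg L _ _) hs1 X
    have hA1 : ‖adRep hF g‖ ≤ 1 := norm_adRep_le_one hF g
    have hAm1 : ‖adRep hF g - 1‖ ≤ 2 * (sph L (k + 1) (k + 1) * t) := by
      refine (norm_adRep_sub_one_le hF g).trans ?_
      rw [dist1_unitaryGroup]; exact mul_le_mul_of_nonneg_left hgm1 zero_le_two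
    have hpow : liftU L M (cTow L M (sph L) X) (cTow_mem L M (sph L) hX) k k ν (parT (lev L k) L M x') = g ^ L := by
      apply Subtype.ext
      rw [SubmonoidClass.coe_pow]
      show NormedSpace.exp (((sph L k k : ℝ) : ℂ) • X) = (NormedSpace.exp (((sph L (k + 1) (k + 1) : ℝ) : ℂ) • X)) ^ L
      rw [exp_smul_pow, mul_sph_succ L hL (Nat.lt_succ_self k), sph_succ_eq L le_rfl]
    have hRk : R k ν (parT (lev L k) L M x') = (adRep hF g) ^ L := by
      show adRep hF (liftU L M (cTow L M (sph L) X) (cTow_mem L M (sph L) hX) k k ν (parT (lev L k) L M x')) = _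
      rw [hpow, map_pow]
    have hRk1 : R (k + 1) ν x' = adRep hF g := rfl
    have key : connTower L M R (k + 1) ν x' - connTower L M R k ν (parT (lev L k) L M x')
        = -((((lev L k : ℕ) : ℂ)) • ((adRep hF g) ^ L - 1 - L • (adRep hF g - 1))) := by
      rw [connTower_eq, connTower_eq, hRk, hRk1, lev_succ', Nat.cast_mul, mul_comm ((L : ℕ) : ℂ) (((lev L k : ℕ)) : ℂ), mul_smul, ← smul_sub,
        ← Nat.cast_smul_eq_nsmul ℂ L, ← smul_neg, neg_sub]
    rw [key, norm_neg, norm_smul, Complex.norm_natCast, cast_lev']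
    have h2 := norm_pow_sub_one_sub_nsmul_le hA1 L
    have hsq : ‖adRep hF g - 1‖ ^ 2 ≤ (2 * (sph L (k + 1) (k + 1) * t)) ^ 2 := pow_le_pow_left₀ (norm_nonneg _) hAm1 2
    have hsph : (L : ℝ) ^ (k + 1) * sph L (k + 1) (k + 1) = 1 := by rw [sph_top, mul_inv_cancel₀ (by positivity)]
    have hLk : (0 : ℝ) < (L : ℝ) ^ k := by positivity
    rw [div_eq_mul_inv]
    -- L^k·L²·(2 s t)² = 4t²·L^k·(L^{k+1} s)²/L^{2k} = 4 t² / L^k ≤ 4 t / L^k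
    calc (L : ℝ) ^ k * ‖(adRep hF g) ^ L - 1 - L • (adRep hF g - 1)‖
        ≤ (L : ℝ) ^ k * ((L : ℝ) ^ 2 * (2 * (sph L (k + 1) (k + 1) * t)) ^ 2) := mul_le_mul_of_nonneg_left (h2.trans (mul_le_mul_of_nonneg_left hsq (by positivity))) hLk.le
      _ = 4 * t ^ 2 * ((L : ℝ) ^ k)⁻¹ * ((L : ℝ) ^ (k + 1) * sph L (k + 1) (k + 1)) ^ 2 := by
          field_simp
          ring
      _ = 4 * t ^ 2 * ((L : ℝ) ^ k)⁻¹ := by rw [hsph, one_pow, mul_one]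
      _ ≤ 4 * t * ((L : ℝ) ^ k)⁻¹ := by
          have : t ^ 2 ≤ t := by nlinarith
          have h0 : 0 ≤ ((L : ℝ) ^ k)⁻¹ := by positivity
          nlinarith
  · rw [hdconn, hdconn, sub_self, norm_zero]; positivity

end Stationary

/-! ## §4 The END at the constant-connection towers -/

section End

variable (L : ℕ) [NeZero L] (M : Fin d → ℕ) [hM : ∀ μ, NeZero (M μ)]
  {n : Type} [Fintype n] [DecidableEq n] {ι : Type} [Fintype ι] [DecidableEq ι] {c : ℝ} {P : Submodule ℝ (Matrix n n ℂ)} {e : ι → Matrix n n ℂ}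
  (hF : CompFamily c P e) (a : ℝ) (ha : 0 < a) [Nonempty n] [Nonempty ι]

/-- **THE (3.26)-SHAPE END AT A CONSTANT-PER-LEVEL TOWER** — every displayed DATA binder of `composed_full_averaging_deltaPrime_rate_of_coherentTowers_top` DISCHARGED for
`u_k^{(i)} ≡ exp(f(k,i)X)`, `X` skew-hermitian with `t = ‖X‖e^{‖X‖} ≤ 1/16`, phases that are coherent (`L·f(k,i+1) = f(k,i)`), flat above the top, in `[0,1]`, with top `f(k,k) ≤ L^{−k}` and
chain differences `0 ≤ f(k,i) − f(k+1,i) ≤ L^{−k}L^{−i}`, node NE3's `LocalRate` at the tower with `C = 4t`, and the END's smallness inequality at the letters `(t, 0, t, L⁻¹, 0, 4t)`: the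
resolvent tower of [free block Laplacian] + [tier B at `Ad u_top`] + [print's composed averaging `TBal(Ad u)` with (124)'s remainders `Erem`] + [`Δ′(u_top)`] converges at rate `ρ`.  The data
are a TOY (constant connection), not Bałaban's minimiser; NE2 NOT proved.
[cite: Balaban1985BackgroundPropagators, (3.10) p.392, (3.15)–(3.16) p.393, (3.26) p.395; Balaban1985Averaging, (42) p.23, (114) p.34, (124) p.36; King1986, Lemma 4.5 (4.38) p.674 (method)] [folklore] -/
theorem composed_full_averaging_deltaPrime_rate_of_coherentTowers_top_cTow (hL : 2 ≤ L) (hd : 1 ≤ d) {ρ : ℝ} (hρ : 3 / (2 * (L : ℝ)) ≤ ρ) (hρ1 : ρ < 1)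
    {X : Matrix n n ℂ} (hX : star X = -X) (ht : ‖X‖ * Real.exp ‖X‖ ≤ 1 / 16) {f : ℕ → ℕ → ℝ}
    (hcoh : ∀ k i, i < k → (L : ℝ) * f k (i + 1) = f k i) (hjunk : ∀ k i, k < i → f k i = 0) (hf0 : ∀ k i, 0 ≤ f k i) (hf1 : ∀ k i, f k i ≤ 1)
    (hftop : ∀ k, f k k ≤ ((L : ℝ) ^ k)⁻¹) (hfD : ∀ k i, i ≤ k → 0 ≤ f k i - f (k + 1) i ∧ f k i - f (k + 1) i ≤ ((L : ℝ)⁻¹) ^ k * ((L : ℝ) ^ i)⁻¹)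
    (hNE3 : LocalRate (bgReadings L M (regClass L M (topAdT L M hF (liftU L M (cTow L M f X) (cTow_mem L M f hX))))) (4 * (‖X‖ * Real.exp ‖X‖)) ((L : ℝ)⁻¹))
    (hsmall : PhiC ι d L a (‖X‖ * Real.exp ‖X‖) < 1) :
    ∃ (u : ℕ → (i : ℕ) → Tor (fine (lev L i) M) → Fin d → (Matrix n n ℂ)ˣ) (hu : ∀ k i y κ, ((u k i y κ : (Matrix n n ℂ)ˣ) : Matrix n n ℂ) ∈ Matrix.unitaryGroup n ℂ) (Cp : ℝ),
      (∀ k i, i < k → u k i = bavgTor (lev L i) L M (u k (i + 1))) ∧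
      (∀ k i y κ, ((u k i y κ : (Matrix n n ℂ)ˣ) : Matrix n n ℂ) = NormedSpace.exp (((f k i : ℝ) : ℂ) • X)) ∧
      TowerLimitRate (fun k => Qlev L M k ⊗ₖ (1 : Matrix ι ι ℂ)) ((L : ℝ) ^ d)
        (fun k => (calDalev L M a ha k ⊗ₖ (1 : Matrix ι ι ℂ)
          + tierBPert L M (topAdT L M hF (liftU L M u hu)) (avgPertFull L M a (fun k => TBal L M (adT L M hF (liftU L M u hu k)) k)
              (fun k => Erem L M (adT L M hF (liftU L M u hu k)) (remCoeffOf L M (fundT L M (liftU L M u hu k)) c e (adT L M hF (liftU L M u hu k))) k))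
              (fun k => deltaPrime (fine (lev L k) M) (lev L k) c e (fun ν x => (topU L M u hu k ν x : Matrix n n ℂ))) k)⁻¹) Cp ρ := by
  have hLr : (2 : ℝ) ≤ L := by exact_mod_cast hL
  set t : ℝ := ‖X‖ * Real.exp ‖X‖ with htdef
  have ht0 : 0 ≤ t := by positivity
  have hρ0 : 0 ≤ ρ := le_trans (by positivity) hρ
  have hLi0 : 0 ≤ (L : ℝ)⁻¹ := inv_nonneg.mpr (Nat.cast_nonneg L)
  have hLi1 : (L : ℝ)⁻¹ ≤ 1 := inv_le_one_of_one_le₀ (by linarith)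
  have hLiρ : (L : ℝ)⁻¹ ≤ ρ := by
    refine le_trans ?_ hρ
    rw [div_eq_mul_inv, mul_inv, ← mul_assoc]
    have : (L : ℝ)⁻¹ = 1 * (L : ℝ)⁻¹ := (one_mul _).symm
    refine le_of_eq_of_le this (mul_le_mul_of_nonneg_right (by norm_num) hLi0)
  refine ⟨cTow L M f X, cTow_mem L M f hX, _, fun k i hik => cTow_coherent L M X (hcoh k i hik), fun k i y κ => cTow_val L M f X k i y κ,
    composed_full_averaging_deltaPrime_rate_of_coherentTowers_top L M hF a ha hL hd (cTow_mem L M f hX) (fun k i hik => cTow_coherent L M X (hcoh k i hik))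
      (fun k i hki => cTow_eq_one L M X (hjunk k i hki))
      (αU := t) (βU := 0) (σU := t) (θc := (L : ℝ)⁻¹) (pU := 0) ht0 le_rfl ht0 hLi0 hLi1 hLiρ hρ hρ1 le_rfl (by rw [mul_zero]; norm_num) (by rw [mul_zero, mul_zero]; norm_num)
      (by unfold Abar; have := Kloop_nonneg (d := d); nlinarith)
      (fun k y μ ν _ => by rw [show cTow L M f X k k = fun _ _ => expUnit (((f k k : ℝ) : ℂ) • X) from rfl, tplaq_const, Units.val_one, sub_self, norm_zero]; positivity)
      (fun k y κ => norm_cTow_top_sub_one_le L M X k (hf0 k k) (hftop k) y κ)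
      (fun k ν μ b => by
        show ‖NormedSpace.exp (((f k k : ℝ) : ℂ) • X) - NormedSpace.exp (((f k k : ℝ) : ℂ) • X)‖ ≤ _
        rw [sub_self, norm_zero]; positivity)
      (fun k i ν b hik => (norm_liftU_succ_sub_le L M hf0 hf1 hX (hfD k i hik) ν b).trans (le_of_eq (by rw [cast_lev', div_eq_mul_inv]; ring)))
      (by positivity) hNE3
      (fun k i x μ r => by rw [YxT_cTow L M f hX]; exact P.zero_mem)
      (bS := 0) (σS := 0) (σS' := 0) (bB := 0) (σB := 0) (σB' := 0) le_rfl le_rfl le_rfl le_rfl le_rfl le_rfl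
      (fun k μ ν x => by rw [Sfield_cTow L M f hX]; simp) (fun k μ ν y => by rw [Sfield_cTow L M f hX, Sfield_cTow L M f hX]; simp)
      (fun k μ ν lam x => by rw [Sfield_cTow L M f hX, Sfield_cTow L M f hX]; simp)
      (fun k μ ν x => by rw [Bfield_cTow L M f hX]; simp) (fun k μ ν y => by rw [Bfield_cTow L M f hX, Bfield_cTow L M f hX]; simp)
      (fun k μ ν lam x => by rw [Bfield_cTow L M f hX, Bfield_cTow L M f hX]; simp)
      hsmall⟩

/-- **NON-VACUITY OF THE END ON AN OPEN SET OF NON-FLAT DATA — BOTH TOWERS**: there is `t₀ > 0` (depending on `d, L, a` and the colour dimension) such that for EVERY skew-hermitian `X`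
with `‖X‖e^{‖X‖} < t₀` BOTH the constant-connection tower `exp(L^{−(k+i)}X)` AND the stationary tower `exp(L^{−i}X)` satisfy every displayed binder of the END of record and its
conclusion; for `X ≠ 0` their finest fields are not `1` (`cTow_ne_one`) and, for non-central `X`, their adjoint transport, tier-B operators, composed averaging tables and (124)-remainders
are NOT the flat ones — until now the END's only witness was the flat tower `…_top_flat`.  Model level; NE2 NOT proved. [folklore] -/
theorem exists_nonflat_coherent_witness (hL : 2 ≤ L) (hd : 1 ≤ d) {ρ : ℝ} (hρ : 3 / (2 * (L : ℝ)) ≤ ρ) (hρ1 : ρ < 1) :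
    ∃ t₀ : ℝ, 0 < t₀ ∧ ∀ X : Matrix n n ℂ, star X = -X → ‖X‖ * Real.exp ‖X‖ < t₀ → ∀ f : ℕ → ℕ → ℝ, (f = cph L ∨ f = sph L) →
      ∃ (u : ℕ → (i : ℕ) → Tor (fine (lev L i) M) → Fin d → (Matrix n n ℂ)ˣ) (hu : ∀ k i y κ, ((u k i y κ : (Matrix n n ℂ)ˣ) : Matrix n n ℂ) ∈ Matrix.unitaryGroup n ℂ) (Cp : ℝ),
        (∀ k i, i < k → u k i = bavgTor (lev L i) L M (u k (i + 1))) ∧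
        (∀ k i y κ, ((u k i y κ : (Matrix n n ℂ)ˣ) : Matrix n n ℂ) = NormedSpace.exp (((f k i : ℝ) : ℂ) • X)) ∧
        TowerLimitRate (fun k => Qlev L M k ⊗ₖ (1 : Matrix ι ι ℂ)) ((L : ℝ) ^ d)
          (fun k => (calDalev L M a ha k ⊗ₖ (1 : Matrix ι ι ℂ)
            + tierBPert L M (topAdT L M hF (liftU L M u hu)) (avgPertFull L M a (fun k => TBal L M (adT L M hF (liftU L M u hu k)) k)
                (fun k => Erem L M (adT L M hF (liftU L M u hu k)) (remCoeffOf L M (fundT L M (liftU L M u hu k)) c e (adT L M hF (liftU L M u hu k))) k))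
                (fun k => deltaPrime (fine (lev L k) M) (lev L k) c e (fun ν x => (topU L M u hu k ν x : Matrix n n ℂ))) k)⁻¹) Cp ρ := by
  have hL1 : 1 ≤ L := le_trans (by norm_num) hL
  have hLr1 : (1 : ℝ) ≤ L := by exact_mod_cast hL1
  obtain ⟨t₁, ht₁, h⟩ := exists_PhiC_lt_one L (ι := ι) (d := d) a
  refine ⟨min t₁ (1 / 16), lt_min ht₁ (by norm_num), fun X hX hXt f hf => ?_⟩
  have ht0 : 0 ≤ ‖X‖ * Real.exp ‖X‖ := by positivity
  have ht16 : ‖X‖ * Real.exp ‖X‖ ≤ 1 / 16 := le_trans hXt.le (min_le_right _ _)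
  have hsmall : PhiC ι d L a (‖X‖ * Real.exp ‖X‖) < 1 := h _ (by rw [abs_of_nonneg ht0]; exact lt_of_lt_of_le hXt (min_le_left _ _))
  have hpow1 : ∀ m : ℕ, ((L : ℝ) ^ m)⁻¹ ≤ 1 := fun m => inv_le_one_of_one_le₀ (one_le_pow₀ hLr1)
  rcases hf with rfl | rfl
  · exact composed_full_averaging_deltaPrime_rate_of_coherentTowers_top_cTow L M hF a ha hL hd hρ hρ1 hX ht16
      (fun k i hik => mul_cph_succ L hL1 hik) (fun k i hki => cph_of_lt L hki) (fun k i => cph_nonneg L k i) (fun k i => cph_le_one L hL1 k i)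
      (fun k => cph_top_le L hL1 k) (fun k i hik => cph_sub_cph_succ L hL1 hik) (localRate_cTow_cph L M hF hX) hsmall
  · refine composed_full_averaging_deltaPrime_rate_of_coherentTowers_top_cTow L M hF a ha hL hd hρ hρ1 hX ht16
      (fun k i hik => mul_sph_succ L hL1 hik) (fun k i hki => sph_of_lt L hki) (fun k i => sph_nonneg L k i)
      (fun k i => by unfold sph; split_ifs <;> [exact hpow1 i; exact zero_le_one])
      (fun k => (sph_top L k).le) (fun k i hik => ?_) (localRate_cTow_sph L M hF hX (by linarith)) hsmall
    rw [sph_succ_eq L hik, sub_self]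
    exact ⟨le_rfl, by positivity⟩

end End

end Summit.QuantumFields.BalabanUV.T4Continuum.NE2.ComposedRemainderCoherentTowerConstant

end
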